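import Summits.Ventures.PercRepro.Benchmarks
import Summits.Ventures.PercRepro.ExploreChain

/-!
# Gladkov's Lemma 1.2

`P(a|b|c)²/P(a|c ∩ b|c) + P(a|b|c)²/P(a|b ∩ b|c) ≤ P(a|b|c) + P(a|b ∩ a|c)²` (Gladkov,
arXiv:2408.08457, Lemma 1.2 / eq. (2); typer-2's `Gladkov24Lemma12`).  Proof (§7.1 of the
paper): the `S₃`-swap of GZ24's inequality (final) gives
`P(a|b|c) − P(a|b ∩ a|c)² ≤ E[1_{a|b|c}(ω) 1_{ab ∪ ac}(ω →_{S₃} ω')]` (`iso_sub_sq_le_sum`), the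
key observation bounds this by `X₁ + X₂` with `X₁ = E[1_{a|b|c}(ω) 1_{ab}(ω →_{S₁} ω')]`
(`sum_iso_union_le`), `X₁ ≤ P(a|b|c) − Y₁` with `Y₁ = E[1_{a|b|c}(ω) 1_{a|b|c}(ω →_{S₁} ω')]`
(`sum_conn_add_sum_iso_le`), and Theorem 5.2 along the chain `S₁` — the exploration of the
cluster of `c` (all to `S`), then of `a` (to `Sᶜ`), then of `b` (to `S`), whose run on `a|b|c`
is the static set `swapSetC` (`run_chainS1`) — gives `Y₁ ≥ P(a|b|c)²/P(a|c ∩ b|c)`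
(`iso_sq_le_swapSetC`); symmetrically for `S₂`.  Main results: `MultiGraph.gladkov_lemma12_events`
and `Gladkov24Lemma12_holds`.
-/

namespace PercRepro

namespace MultiGraph

open Finset

variable {V E : Type*} [DecidableEq V] [DecidableEq E] (G : MultiGraph V E)

variable {G}

section Lemma12

variable [Fintype E]

omit [DecidableEq V] [DecidableEq E] [Fintype E] in
/-- Membership in `{a ≁ c} ∩ {b ≁ c}` depends only on the cluster of `c`. -/
theorem mem_sep_inter_of_cluster_eq (a b c : V) (ω ζ : Config E)
    (h : G.cluster ω c = G.cluster ζ c) :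
    ω ∈ G.sepEvent a c ∩ G.sepEvent b c ↔ ζ ∈ G.sepEvent a c ∩ G.sepEvent b c := by
  have ha : G.Conn ω c a ↔ G.Conn ζ c a := by
    change a ∈ G.cluster ω c ↔ a ∈ G.cluster ζ c
    rw [h]
  have hb : G.Conn ω c b ↔ G.Conn ζ c b := by
    change b ∈ G.cluster ω c ↔ b ∈ G.cluster ζ c
    rw [h]
  simp only [Set.mem_inter_iff, mem_sepEvent, G.conn_comm (u := a), G.conn_comm (u := b), ha, hb]

/-- `a|b|c` as a set. -/
abbrev isoEvent (a b c : V) : Set (Config E) := G.sepEvent a b ∩ G.sepEvent a c ∩ G.sepEvent b c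

/-- **The Theorem 5.2 bound along `S₁`** (the swap of GZ24 / `swapSetC`):
`P(a|b|c)² ≤ P(a|c ∩ b|c) · E[1_{a|b|c}(ω) · 1_{a|b|c}(ω →_{S₁} ω')]` with `S₁ = swapSetC ω a b c`. -/
theorem iso_sq_le_swapSetC {p : E → ℝ} (hp : IsProb p) (a b c : V) :
    prob p (G.isoEvent a b c) ^ 2 ≤
      prob p (G.sepEvent a c ∩ G.sepEvent b c) *
        ∑ ω, ∑ ω', weight p ω * weight p ω' *
          ((G.isoEvent a b c).indicator 1 ω *
            (G.isoEvent a b c).indicator 1 (mix (G.swapSetC ω a b c) ω ω')) := by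
  have hM : IsLowerSet (G.isoEvent a b c) :=
    ((G.isLowerSet_sepEvent a b).inter (G.isLowerSet_sepEvent a c)).inter
      (G.isLowerSet_sepEvent b c)
  have h := DTree.cauchy_schwarz_lower hp (allS_exploreTree (G := G) c) (continues_chainS1 a b c)
    (proper_chainS1 a b c) (decides_exploreTree c (mem_sep_inter_of_cluster_eq (G := G) a b c)) hM
  have hAM : (G.sepEvent a c ∩ G.sepEvent b c) ∩ G.isoEvent a b c = G.isoEvent a b c :=
    Set.inter_eq_right.mpr fun ω hω => ⟨hω.1.2, hω.2⟩
  rw [hAM] at h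
  refine h.trans (le_of_eq ?_)
  congr 1
  refine Finset.sum_congr rfl fun ω _ => Finset.sum_congr rfl fun ω' _ => ?_
  by_cases hω : ω ∈ G.isoEvent a b c
  · obtain ⟨⟨hab, hac⟩, hbc⟩ := hω
    rw [run_chainS1 hab hac hbc]
  · rw [Set.indicator_of_notMem hω]
    simp

end Lemma12

section Lemma12Assembly

variable [Fintype E]

omit [DecidableEq V] [DecidableEq E] [Fintype E] in
/-- `isoEvent` is symmetric in `b`, `c`. -/
theorem isoEvent_comm (a b c : V) : G.isoEvent a c b = G.isoEvent a b c := by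
  ext ω
  simp only [isoEvent, Set.mem_inter_iff, mem_sepEvent]
  rw [G.conn_comm (u := c) (v := b)]
  tauto

omit [DecidableEq V] in
/-- `S₁`-type swaps with `Ψ ∈ a~b` and `Ψ ∈ a|b|c` are exclusive: `X₁ + Y₁ ≤ P(a|b|c)`. -/
theorem sum_conn_add_sum_iso_le {p : E → ℝ} (hp : IsProb p) (a b c : V) (S : Config E → Set E) :
    (∑ ω, ∑ ω', weight p ω * weight p ω' *
        ((G.isoEvent a b c).indicator 1 ω * (G.connEvent a b).indicator 1 (mix (S ω) ω ω'))) +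
      (∑ ω, ∑ ω', weight p ω * weight p ω' *
        ((G.isoEvent a b c).indicator 1 ω * (G.isoEvent a b c).indicator 1 (mix (S ω) ω ω'))) ≤
      prob p (G.isoEvent a b c) := by
  rw [← sum_sum_weight_mul_indicator_left p (G.isoEvent a b c), ← Finset.sum_add_distrib]
  refine Finset.sum_le_sum fun ω _ => ?_
  rw [← Finset.sum_add_distrib]
  refine Finset.sum_le_sum fun ω' _ => ?_
  rw [← mul_add]
  refine mul_le_mul_of_nonneg_left ?_ (mul_nonneg (weight_nonneg hp ω) (weight_nonneg hp ω'))
  rw [← mul_add]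
  by_cases hω : ω ∈ G.isoEvent a b c
  · rw [Set.indicator_of_mem hω, Pi.one_apply, one_mul]
    by_cases h1 : mix (S ω) ω ω' ∈ G.connEvent a b
    · have h2 : mix (S ω) ω ω' ∉ G.isoEvent a b c := fun h => h.1.1 h1
      rw [Set.indicator_of_mem h1, Set.indicator_of_notMem h2]; simp
    · rw [Set.indicator_of_notMem h1, zero_add]
      exact Set.indicator_le_self' (fun _ _ => zero_le_one) _
  · rw [Set.indicator_of_notMem hω]; simp

omit [DecidableEq V] in
/-- The key observation, summed: `E[1_{a|b|c}(ω) 1_{ab ∪ ac}(Φ₂)] ≤ X₁ + X₂`. -/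
theorem sum_iso_union_le {p : E → ℝ} (hp : IsProb p) (a b c : V) :
    (∑ ω, ∑ ω', weight p ω * weight p ω' *
        ((G.isoEvent a b c).indicator 1 ω *
          (G.connEvent a b ∪ G.connEvent a c).indicator 1 (mix (G.swapSetBC ω a b c) ω ω'))) ≤
      (∑ ω, ∑ ω', weight p ω * weight p ω' *
        ((G.isoEvent a b c).indicator 1 ω *
          (G.connEvent a b).indicator 1 (mix (G.swapSetC ω a b c) ω ω'))) +
      (∑ ω, ∑ ω', weight p ω * weight p ω' *
        ((G.isoEvent a b c).indicator 1 ω *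
          (G.connEvent a c).indicator 1 (mix (G.swapSetC ω a c b) ω ω'))) := by
  rw [← Finset.sum_add_distrib]
  refine Finset.sum_le_sum fun ω _ => ?_
  rw [← Finset.sum_add_distrib]
  refine Finset.sum_le_sum fun ω' _ => ?_
  rw [← mul_add, ← mul_add]
  refine mul_le_mul_of_nonneg_left ?_ (mul_nonneg (weight_nonneg hp ω) (weight_nonneg hp ω'))
  by_cases hω : ω ∈ G.isoEvent a b c
  · obtain ⟨⟨hab, hac⟩, hbc⟩ := hω
    rw [Set.indicator_of_mem (show ω ∈ G.isoEvent a b c from ⟨⟨hab, hac⟩, hbc⟩), Pi.one_apply,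
      one_mul, one_mul]
    by_cases hU : mix (G.swapSetBC ω a b c) ω ω' ∈ G.connEvent a b ∪ G.connEvent a c
    · rw [Set.indicator_of_mem hU, Pi.one_apply]
      rcases conn_swapSetC_of_conn_swapSetBC hab hac hbc hU with h | h
      · rw [Set.indicator_of_mem (show _ ∈ G.connEvent a b from h), Pi.one_apply]
        have : (0 : ℝ) ≤ (G.connEvent a c).indicator 1 (mix (G.swapSetC ω a c b) ω ω') :=
          Set.indicator_nonneg (fun _ _ => zero_le_one) _
        linarith
      · rw [Set.indicator_of_mem (show _ ∈ G.connEvent a c from h), Pi.one_apply]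
        have : (0 : ℝ) ≤ (G.connEvent a b).indicator 1 (mix (G.swapSetC ω a b c) ω ω') :=
          Set.indicator_nonneg (fun _ _ => zero_le_one) _
        linarith
    · rw [Set.indicator_of_notMem hU]
      exact add_nonneg (Set.indicator_nonneg (fun _ _ => zero_le_one) _)
        (Set.indicator_nonneg (fun _ _ => zero_le_one) _)
  · rw [Set.indicator_of_notMem hω]; simp

omit [DecidableEq V] in
/-- The lower bound from the `S₃` swap: `P(a|b|c) − P(a|b ∩ a|c)² ≤ E[1_{a|b|c}(ω) 1_{ab ∪ ac}(Φ₂)]`. -/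
theorem iso_sub_sq_le_sum {p : E → ℝ} (hp : IsProb p) (a b c : V) :
    prob p (G.isoEvent a b c) - prob p (G.sepEvent a b ∩ G.sepEvent a c) ^ 2 ≤
      ∑ ω, ∑ ω', weight p ω * weight p ω' *
        ((G.isoEvent a b c).indicator 1 ω *
          (G.connEvent a b ∪ G.connEvent a c).indicator 1 (mix (G.swapSetBC ω a b c) ω ω')) := by
  set A₀ := G.sepEvent a b ∩ G.sepEvent a c with hA₀
  set U := G.connEvent a b ∪ G.connEvent a c with hU
  -- `P(A₀) P(U) = E[1_{A₀}(ω) 1_U(Φ₂)]`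
  have hswap := prob_mul_prob_eq_sum_swap p (recoverable_swapSetBC (G := G) a b c) A₀ U
  have hrw : ∀ ω ω', A₀.indicator (1 : Config E → ℝ) (mix (G.swapSetBC ω a b c)ᶜ ω ω') =
      A₀.indicator 1 ω := by
    intro ω ω'
    by_cases h : ω ∈ A₀
    · rw [Set.indicator_of_mem h, Set.indicator_of_mem
        ((mem_sep_mix_compl_swapSetBC_iff (G := G) ω ω' a b c).mpr h)]
      rfl
    · rw [Set.indicator_of_notMem h, Set.indicator_of_notMem
        (fun h' => h ((mem_sep_mix_compl_swapSetBC_iff (G := G) ω ω' a b c).mp h'))]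
  simp only [hrw] at hswap
  -- `U = A₀ᶜ`
  have hUc : U = A₀ᶜ := by
    ext ω
    simp only [hU, hA₀, Set.mem_union, Set.mem_compl_iff, Set.mem_inter_iff, mem_connEvent,
      mem_sepEvent]
    tauto
  have hPU : prob p U = 1 - prob p A₀ := by rw [hUc, prob_compl]
  -- `1_{A₀} = 1_{a|b|c} + 1_{a|bc}` and `a|bc` part `≤ P(a|bc)`
  set N := G.connEvent b c ∩ G.sepEvent a b with hN
  have hsplit : ∀ ω, A₀.indicator (1 : Config E → ℝ) ω =
      (G.isoEvent a b c).indicator 1 ω + N.indicator 1 ω := by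
    intro ω
    obtain ⟨h1, h2, h3⟩ := G.conn_three_trans a b c (ω := ω)
    by_cases hω : ω ∈ A₀
    · rw [Set.indicator_of_mem hω]
      by_cases hbc : G.Conn ω b c
      · have hN' : ω ∈ N := ⟨hbc, hω.1⟩
        have hI : ω ∉ G.isoEvent a b c := fun h => h.2 hbc
        rw [Set.indicator_of_mem hN', Set.indicator_of_notMem hI]; simp
      · have hI : ω ∈ G.isoEvent a b c := ⟨hω, hbc⟩
        have hN' : ω ∉ N := fun h => hbc h.1
        rw [Set.indicator_of_mem hI, Set.indicator_of_notMem hN']; simp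
    · rw [Set.indicator_of_notMem hω]
      have hI : ω ∉ G.isoEvent a b c := fun h => hω h.1
      have hN' : ω ∉ N := fun h => hω ⟨h.2, fun hac => h.2 (hac.trans h.1.symm)⟩
      rw [Set.indicator_of_notMem hI, Set.indicator_of_notMem hN']; simp
  have hNle : (∑ ω, ∑ ω', weight p ω * weight p ω' *
      (N.indicator 1 ω * U.indicator 1 (mix (G.swapSetBC ω a b c) ω ω'))) ≤ prob p N := by
    rw [← sum_sum_weight_mul_indicator_left p N]
    refine Finset.sum_le_sum fun ω _ => Finset.sum_le_sum fun ω' _ => ?_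
    refine mul_le_mul_of_nonneg_left ?_ (mul_nonneg (weight_nonneg hp ω) (weight_nonneg hp ω'))
    calc N.indicator (1 : Config E → ℝ) ω * U.indicator 1 (mix (G.swapSetBC ω a b c) ω ω')
        ≤ N.indicator 1 ω * 1 := by
          refine mul_le_mul_of_nonneg_left ?_ (Set.indicator_nonneg (fun _ _ => zero_le_one) _)
          exact Set.indicator_le_self' (fun _ _ => zero_le_one) _
      _ = N.indicator 1 ω := mul_one _
  have hA₀N : prob p A₀ = prob p (G.isoEvent a b c) + prob p N := by
    have h := prob_inter_add_prob_inter_compl p A₀ (G.connEvent b c)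
    have e1 : A₀ ∩ G.connEvent b c = N := by
      ext ω
      obtain ⟨h1, h2, h3⟩ := G.conn_three_trans a b c (ω := ω)
      simp only [hA₀, hN, Set.mem_inter_iff, mem_sepEvent, mem_connEvent]
      tauto
    have e2 : A₀ ∩ (G.connEvent b c)ᶜ = G.isoEvent a b c := rfl
    rw [e1, e2] at h
    linarith
  -- assemble
  have hsum : ∑ ω, ∑ ω', weight p ω * weight p ω' *
      (A₀.indicator 1 ω * U.indicator 1 (mix (G.swapSetBC ω a b c) ω ω')) =
      (∑ ω, ∑ ω', weight p ω * weight p ω' *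
        ((G.isoEvent a b c).indicator 1 ω * U.indicator 1 (mix (G.swapSetBC ω a b c) ω ω'))) +
      ∑ ω, ∑ ω', weight p ω * weight p ω' *
        (N.indicator 1 ω * U.indicator 1 (mix (G.swapSetBC ω a b c) ω ω')) := by
    rw [← Finset.sum_add_distrib]
    refine Finset.sum_congr rfl fun ω _ => ?_
    rw [← Finset.sum_add_distrib]
    refine Finset.sum_congr rfl fun ω' _ => ?_
    rw [hsplit ω]; ring
  rw [hsum] at hswap
  rw [hPU] at hswap
  nlinarith [hswap, hNle, hA₀N]

/-- **Gladkov's Lemma 1.2** (arXiv:2408.08457, eq. (2)), event form: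
`P(a|b|c)²/P(a|c ∩ b|c) + P(a|b|c)²/P(a|b ∩ b|c) ≤ P(a|b|c) + P(a|b ∩ a|c)²`. -/
theorem gladkov_lemma12_events {p : E → ℝ} (hp : IsProb p) (a b c : V) :
    prob p (G.isoEvent a b c) ^ 2 / prob p (G.sepEvent a c ∩ G.sepEvent b c) +
      prob p (G.isoEvent a b c) ^ 2 / prob p (G.sepEvent a b ∩ G.sepEvent b c) ≤
      prob p (G.isoEvent a b c) + prob p (G.sepEvent a b ∩ G.sepEvent a c) ^ 2 := by
  set B := G.isoEvent a b c with hB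
  -- the two Theorem 5.2 bounds
  have hY₁ := iso_sq_le_swapSetC (G := G) hp a b c
  have hY₂ := iso_sq_le_swapSetC (G := G) hp a c b
  rw [isoEvent_comm] at hY₂
  have hD₂ : G.sepEvent a b ∩ G.sepEvent c b = G.sepEvent a b ∩ G.sepEvent b c := by
    ext ω
    simp only [Set.mem_inter_iff, mem_sepEvent, G.conn_comm (u := c) (v := b)]
  rw [hD₂] at hY₂
  set Y₁ := ∑ ω, ∑ ω', weight p ω * weight p ω' *
    (B.indicator 1 ω * B.indicator 1 (mix (G.swapSetC ω a b c) ω ω')) with hY₁def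
  set Y₂ := ∑ ω, ∑ ω', weight p ω * weight p ω' *
    (B.indicator 1 ω * B.indicator 1 (mix (G.swapSetC ω a c b) ω ω')) with hY₂def
  set X₁ := ∑ ω, ∑ ω', weight p ω * weight p ω' *
    (B.indicator 1 ω * (G.connEvent a b).indicator 1 (mix (G.swapSetC ω a b c) ω ω')) with hX₁def
  set X₂ := ∑ ω, ∑ ω', weight p ω * weight p ω' *
    (B.indicator 1 ω * (G.connEvent a c).indicator 1 (mix (G.swapSetC ω a c b) ω ω')) with hX₂def
  have h1 : X₁ + Y₁ ≤ prob p B := sum_conn_add_sum_iso_le (G := G) hp a b c (fun ω => G.swapSetC ω a b c)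
  have h2 : X₂ + Y₂ ≤ prob p B := by
    have := sum_conn_add_sum_iso_le (G := G) hp a c b (fun ω => G.swapSetC ω a c b)
    rwa [isoEvent_comm] at this
  have h3 := sum_iso_union_le (G := G) hp a b c
  have h4 := iso_sub_sq_le_sum (G := G) hp a b c
  have hYnn₁ : 0 ≤ Y₁ := Finset.sum_nonneg fun ω _ => Finset.sum_nonneg fun ω' _ =>
    mul_nonneg (mul_nonneg (weight_nonneg hp ω) (weight_nonneg hp ω'))
      (mul_nonneg (Set.indicator_nonneg (fun _ _ => zero_le_one) _)
        (Set.indicator_nonneg (fun _ _ => zero_le_one) _))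
  have hYnn₂ : 0 ≤ Y₂ := Finset.sum_nonneg fun ω _ => Finset.sum_nonneg fun ω' _ =>
    mul_nonneg (mul_nonneg (weight_nonneg hp ω) (weight_nonneg hp ω'))
      (mul_nonneg (Set.indicator_nonneg (fun _ _ => zero_le_one) _)
        (Set.indicator_nonneg (fun _ _ => zero_le_one) _))
  -- divisions
  have hdiv : ∀ (D Y : ℝ), 0 ≤ D → 0 ≤ Y → prob p B ^ 2 ≤ D * Y → prob p B ^ 2 / D ≤ Y := by
    intro D Y hD hY h
    rcases hD.lt_or_eq with hD' | hD'
    · rw [div_le_iff₀ hD']; linarith [h]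
    · rw [← hD', div_zero]; exact hY
  have hd₁ := hdiv _ _ (prob_nonneg hp _) hYnn₁ hY₁
  have hd₂ := hdiv _ _ (prob_nonneg hp _) hYnn₂ hY₂
  -- `Y₁ + Y₂ ≤ P(B) + P(A₀)²`
  have hmain : Y₁ + Y₂ ≤ prob p B + prob p (G.sepEvent a b ∩ G.sepEvent a c) ^ 2 := by
    linarith [h1, h2, h3, h4]
  linarith [hd₁, hd₂, hmain]


end Lemma12Assembly

end MultiGraph

/-- `P(a|b|c) + P(ac|b) = P(a|b ∩ b|c)` (`b` isolated) in the engine's rows. -/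
theorem law3_four_add_two {V E : Type*} [Fintype E] [DecidableEq E] (G : MultiGraph V E)
    (p : E → ℝ) (a b c : V) :
    G.law3 p a b c 4 + G.law3 p a b c 2 = prob p (G.sepEvent a b ∩ G.sepEvent b c) := by
  rw [MultiGraph.law3_four, MultiGraph.law3_two, G.partitionEvent_row_a_b_c,
    G.partitionEvent_row_ac_b]
  have h := prob_inter_add_prob_inter_compl p (G.sepEvent a b ∩ G.sepEvent b c) (G.connEvent a c)
  have e1 : G.sepEvent a b ∩ G.sepEvent b c ∩ G.connEvent a c = G.connEvent a c ∩ G.sepEvent a b := by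
    ext ω
    obtain ⟨h1, h2, h3⟩ := G.conn_three_trans a b c (ω := ω)
    simp only [Set.mem_inter_iff, MultiGraph.mem_connEvent, MultiGraph.mem_sepEvent]
    tauto
  have e2 : G.sepEvent a b ∩ G.sepEvent b c ∩ (G.connEvent a c)ᶜ =
      G.sepEvent a b ∩ G.sepEvent a c ∩ G.sepEvent b c := by
    ext ω
    simp only [Set.mem_inter_iff, Set.mem_compl_iff, MultiGraph.mem_connEvent,
      MultiGraph.mem_sepEvent]
    tauto
  rw [e1, e2] at h
  linarith

/-- `P(a|b|c) + P(ab|c) = P(a|c ∩ b|c)` (`c` isolated) in the engine's rows. -/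
theorem law3_four_add_one {V E : Type*} [Fintype E] [DecidableEq E] (G : MultiGraph V E)
    (p : E → ℝ) (a b c : V) :
    G.law3 p a b c 4 + G.law3 p a b c 1 = prob p (G.sepEvent a c ∩ G.sepEvent b c) := by
  rw [MultiGraph.law3_four, MultiGraph.law3_one, G.partitionEvent_row_a_b_c,
    G.partitionEvent_row_ab_c]
  have h := prob_inter_add_prob_inter_compl p (G.sepEvent a c ∩ G.sepEvent b c) (G.connEvent a b)
  have e1 : G.sepEvent a c ∩ G.sepEvent b c ∩ G.connEvent a b = G.connEvent a b ∩ G.sepEvent a c := by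
    ext ω
    obtain ⟨h1, h2, h3⟩ := G.conn_three_trans a b c (ω := ω)
    simp only [Set.mem_inter_iff, MultiGraph.mem_connEvent, MultiGraph.mem_sepEvent]
    tauto
  have e2 : G.sepEvent a c ∩ G.sepEvent b c ∩ (G.connEvent a b)ᶜ =
      G.sepEvent a b ∩ G.sepEvent a c ∩ G.sepEvent b c := by
    ext ω
    simp only [Set.mem_inter_iff, Set.mem_compl_iff, MultiGraph.mem_connEvent,
      MultiGraph.mem_sepEvent]
    tauto
  rw [e1, e2] at h
  linarith

/-- **`Gladkov24Lemma12` holds**: Gladkov's Lemma 1.2 in the engine's rows,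
`B²/(B + P2) + B²/(B + P1) ≤ B + (B + P3)²`. -/
theorem Gladkov24Lemma12_holds : Gladkov24Lemma12 := by
  intro V E _ _ G p hp a b c _
  classical
  rw [law3_four_add_two, law3_four_add_one, law3_four_add_three, MultiGraph.law3_four,
    G.partitionEvent_row_a_b_c, add_comm]
  exact G.gladkov_lemma12_events hp a b c

end PercRepro
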